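/-
Copyright: derived here (Resolution Observatory cell `pub-rosobs`, carver gen 57). AI-written Lean; AI review is weaker than expert
review.  Companion file of the cell's POLYNOMIAL weighted-centre model `W(f)`: the GRADED form of engine 1's LEMMA CP / CP′
("pure vectors of composites and inverses", THEOREM-FC-eng1-g37 §2; CARVER-NOTES-eng1-g37 T46; README-g56 §4 ask (c)) — the
variable side condition `hvars` of `WeightedCentrePureVectors.pureVec_comp` is DISCHARGED from gradedness
(`WeightedCentreGradedIsotropy.IsGradedHom`) and "no pure term on the lighter slots".
Instrument — NOT a resolution theorem and NOT a statement about the invariant of [AbramovichTemkinWlodarczyk2024].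
-/
import Literature.AlgebraicGeometry.Resolution.WeightedCentreGradedIsotropy
import Literature.AlgebraicGeometry.Resolution.WeightedCentrePureVectors
import HarnessLib

/-!
# Graded pure vectors: LEMMA CP / CP′ with the side condition read off the grading

Setting of `WeightedCentreGradedIsotropy` and `WeightedCentrePureVectors`: `A₀ = k[ε_ι] = MvPolynomial ι k`, the parameter
ring `A₀[σ] = A₀[X]`, weights `w : ι → M` on the `ε`-slots and `deg σ = ρ`, ring endomorphisms `Φ, Ψ` of `A₀[X]`, the pure
vector `pureVec Φ i = (Φ ε_i)(ε = 0) ∈ k[σ]` (its `σ^s`-coefficient is `pureCoeff Φ i s`, `coeff_pureVec_eq_pureCoeff`).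

* `weight_le_of_mem_vars_of_isWeightedHomogeneous` : with NONNEGATIVE weights, every variable `ε_j` of a `w`-homogeneous
  `a ∈ k[ε]` of weight `n` has `w j ≤ n`; hence (`IsTW.weight_lt_of_mem_vars`) every `ε`-variable of a `σ^s`-coefficient,
  `s ≥ 1`, of an element of total weight `n` is STRICTLY lighter than `n` when `ρ > 0`.
* `IsGradedHom.pureVec_eq_zero_of_mem_vars` : if `Ψ` is graded and `Ψ ε_i ≡ ε_i (mod σ)`, every `ε`-variable of the impure part
  `Ψ ε_i − ε_i` is lighter than `w i`; so if `Φ` has no pure term on the slots lighter than `w i`, the hypothesis `hvars` of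
  `pureVec_comp` holds.
* **graded LEMMA CP** (`IsGradedHom.pureVec_comp`): `Φ, Ψ` graded, `Φ σ = σ`, `Ψ ε_i ≡ ε_i (mod σ)`, `Φ` pure-free below `w i`
  ⟹ `pureVec (Φ ∘ Ψ) i = pureVec Φ i + pureVec Ψ i`; **graded CP′** (`IsGradedHom.pureVec_eq_neg_of_comp_apply`);
  the composite of two substitutions pure-free below `m` is pure-free below `m` (`IsGradedHom.pureVec_comp_eq_zero_of_lt`), and
  the THREE-FACTOR form used in FC (B3) (`IsGradedHom.pureVec_comp_comp`): on the slots of weight `≤ m` the pure vector of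
  `Φ ∘ Ψ ∘ Θ` is the sum of the three pure vectors.
* graded FC (A) (`IsGradedHom.pureVec_comp_of_twistConj_apply`, `…_coeff_eq_zero_of_even`): the even-class cancellation of
  `WeightedCentrePureVectors` with `hvars` discharged the same way.
* `IsGradedHom.coeff_pureVec_eq_zero` : for graded `Φ` the pure vector of slot `i` is concentrated in the exponents `s` with
  `s • ρ = w i` (restating `IsGradedHom.smul_eq_of_pureCoeff_ne_zero`).

What is NOT here (engine 1's modelling): the weight table, `w*`, the existence of inverses, the free hypotheses of LEMMA FC and its
conclusion.  The base ring `k` is an arbitrary commutative ring (the engine uses `k`, `B′ = k[t]/(1+t^m)` and `k⟦s⟧`).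

Pattern cite [cite: AbramovichTemkinWlodarczyk2024, Thm. 5.3.1 (2)–(3) (p. 1578)] (weighted blow-ups and their gradings, as in
`WeightedCentreGradedIsotropy`); formalisation and statements ours, elementary.
-/

namespace Literature.AlgebraicGeometry.Resolution.WeightedBlowup

open Polynomial

section WeightBound

variable {k : Type*} [CommRing k] {ι : Type*} {M : Type*} [AddCommGroup M] [PartialOrder M] [IsOrderedAddMonoid M]
  {w : ι → M} {ρ : M}

/-- With nonnegative weights, a variable `ε_j` occurring in a `w`-homogeneous `a ∈ k[ε]` of weight `n` has `w j ≤ n` (ours,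
bookkeeping). [cite: AbramovichTemkinWlodarczyk2024, Thm. 5.3.1 (2)–(3) (p. 1578)] -/
theorem weight_le_of_mem_vars_of_isWeightedHomogeneous (hw : ∀ j, 0 ≤ w j) {a : MvPolynomial ι k} {n : M}
    (ha : MvPolynomial.IsWeightedHomogeneous w a n) {j : ι} (hj : j ∈ a.vars) : w j ≤ n := by
  obtain ⟨d, hd, hjd⟩ := (MvPolynomial.mem_vars_iff_mem_support j).mp hj
  have hwd : Finsupp.weight w d = n := ha (MvPolynomial.mem_support_iff.mp hd)
  rw [← hwd]
  exact Finsupp.le_weight_of_ne_zero hw (Finsupp.mem_support_iff.mp hjd)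

/-- For `f` of total weight `n`, a variable `ε_j` of the `σ^s`-coefficient has `w j ≤ n − s•ρ` (ours, bookkeeping).
[cite: AbramovichTemkinWlodarczyk2024, Thm. 5.3.1 (2)–(3) (p. 1578)] -/
theorem IsTW.weight_le_of_mem_vars (hw : ∀ j, 0 ≤ w j) {n : M} {f : (MvPolynomial ι k)[X]} (hf : IsTW w ρ n f)
    {s : ℕ} {j : ι} (hj : j ∈ (f.coeff s).vars) : w j ≤ n - s • ρ :=
  weight_le_of_mem_vars_of_isWeightedHomogeneous hw (hf s) hj

/-- For `f` of total weight `n` and `ρ > 0`, a variable `ε_j` of a `σ^s`-coefficient with `s ≠ 0` is STRICTLY lighter than `n`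
(ours, bookkeeping). [cite: AbramovichTemkinWlodarczyk2024, Thm. 5.3.1 (2)–(3) (p. 1578)] -/
theorem IsTW.weight_lt_of_mem_vars (hw : ∀ j, 0 ≤ w j) (hρ : 0 < ρ) {n : M} {f : (MvPolynomial ι k)[X]}
    (hf : IsTW w ρ n f) {s : ℕ} (hs : s ≠ 0) {j : ι} (hj : j ∈ (f.coeff s).vars) : w j < n :=
  (hf.weight_le_of_mem_vars hw hj).trans_lt (sub_lt_self n (nsmul_pos hρ hs))

end WeightBound

section GradedPure

variable {k : Type*} [CommRing k] {ι : Type*} {M : Type*} [AddCommGroup M] [PartialOrder M] [IsOrderedAddMonoid M]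
  {w : ι → M} {ρ : M}

/-- The `σ^s`-coefficient of the pure vector IS the pure coefficient of `WeightedCentreGradedIsotropy` (plumbing; both files are
imported here). [cite: AbramovichTemkinWlodarczyk2024, Thm. 5.3.1 (2)–(3) (p. 1578)] -/
theorem coeff_pureVec_eq_pureCoeff (Φ : (MvPolynomial ι k)[X] →+* (MvPolynomial ι k)[X]) (i : ι) (s : ℕ) :
    (pureVec Φ i).coeff s = pureCoeff Φ i s :=
  coeff_pureVec Φ i s

omit [PartialOrder M] [IsOrderedAddMonoid M] in
/-- For graded `Φ`, the pure vector of slot `i` lives in the exponents `s` with `s•ρ = w i` (ours; restates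
`IsGradedHom.smul_eq_of_pureCoeff_ne_zero`). [cite: AbramovichTemkinWlodarczyk2024, Thm. 5.3.1 (2)–(3) (p. 1578)] -/
theorem IsGradedHom.coeff_pureVec_eq_zero {Φ : (MvPolynomial ι k)[X] →+* (MvPolynomial ι k)[X]} (hΦ : IsGradedHom w ρ Φ)
    {i : ι} {s : ℕ} (hs : s • ρ ≠ w i) : (pureVec Φ i).coeff s = 0 := by
  rw [coeff_pureVec_eq_pureCoeff]
  by_contra h
  exact hs (hΦ.smul_eq_of_pureCoeff_ne_zero h)

/-- **The side condition of LEMMA CP from the grading** (ours): if `Ψ` is graded, `Ψ ε_i ≡ ε_i (mod σ)` and `Φ` has no pure term on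
the slots STRICTLY lighter than `w i` (nonnegative weights, `ρ > 0`), then every `ε`-variable of the impure part `Ψ ε_i − ε_i` is a
slot on which `Φ` has no pure term. [cite: AbramovichTemkinWlodarczyk2024, Thm. 5.3.1 (2)–(3) (p. 1578)] -/
theorem IsGradedHom.pureVec_eq_zero_of_mem_vars {Φ Ψ : (MvPolynomial ι k)[X] →+* (MvPolynomial ι k)[X]}
    (hΨ : IsGradedHom w ρ Ψ) (hw : ∀ j, 0 ≤ w j) (hρ : 0 < ρ) (i : ι)
    (hmod : Ψ (C (MvPolynomial.X i)) - C (MvPolynomial.X i) ∈ Ideal.span {(X : (MvPolynomial ι k)[X])})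
    (hpure : ∀ j, w j < w i → pureVec Φ j = 0) :
    ∀ s, ∀ j ∈ ((Ψ (C (MvPolynomial.X i)) - C (MvPolynomial.X i)).coeff s).vars, pureVec Φ j = 0 := by
  intro s j hj
  rcases s with _ | s
  · rw [Ideal.mem_span_singleton, Polynomial.X_dvd_iff] at hmod
    rw [hmod, MvPolynomial.vars_0] at hj
    exact absurd hj (Finset.notMem_empty j)
  · refine hpure j ?_
    rw [coeff_sub, coeff_C, if_neg (Nat.succ_ne_zero s), sub_zero] at hj
    exact (hΨ.isTW_CX i).weight_lt_of_mem_vars hw hρ (Nat.succ_ne_zero s) hj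

/-- **Graded LEMMA CP** (ours): `Φ, Ψ` graded, `Φ σ = σ`, `Ψ ε_i ≡ ε_i (mod σ)`, `Φ` pure-free on the slots lighter than `w i`
⟹ `pureVec (Φ ∘ Ψ) i = pureVec Φ i + pureVec Ψ i`. [cite: AbramovichTemkinWlodarczyk2024, Thm. 5.3.1 (2)–(3) (p. 1578)] -/
theorem IsGradedHom.pureVec_comp {Φ Ψ : (MvPolynomial ι k)[X] →+* (MvPolynomial ι k)[X]} (hΦ : IsGradedHom w ρ Φ)
    (hΨ : IsGradedHom w ρ Ψ) (hX : Φ X = X) (hw : ∀ j, 0 ≤ w j) (hρ : 0 < ρ) (i : ι)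
    (hmod : Ψ (C (MvPolynomial.X i)) - C (MvPolynomial.X i) ∈ Ideal.span {(X : (MvPolynomial ι k)[X])})
    (hpure : ∀ j, w j < w i → pureVec Φ j = 0) :
    pureVec (Φ.comp Ψ) i = pureVec Φ i + pureVec Ψ i :=
  WeightedBlowup.pureVec_comp Φ Ψ hΦ.map_C_C hX i (hΨ.pureVec_eq_zero_of_mem_vars hw hρ i hmod hpure)

/-- **Graded LEMMA CP′** (ours): under the hypotheses of graded CP, if `Φ (Ψ ε_i) = ε_i` then `pureVec Ψ i = − pureVec Φ i`.
[cite: AbramovichTemkinWlodarczyk2024, Thm. 5.3.1 (2)–(3) (p. 1578)] -/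
theorem IsGradedHom.pureVec_eq_neg_of_comp_apply {Φ Ψ : (MvPolynomial ι k)[X] →+* (MvPolynomial ι k)[X]}
    (hΦ : IsGradedHom w ρ Φ) (hΨ : IsGradedHom w ρ Ψ) (hX : Φ X = X) (hw : ∀ j, 0 ≤ w j) (hρ : 0 < ρ) (i : ι)
    (hmod : Ψ (C (MvPolynomial.X i)) - C (MvPolynomial.X i) ∈ Ideal.span {(X : (MvPolynomial ι k)[X])})
    (hpure : ∀ j, w j < w i → pureVec Φ j = 0) (hid : Φ (Ψ (C (MvPolynomial.X i))) = C (MvPolynomial.X i)) :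
    pureVec Ψ i = - pureVec Φ i :=
  WeightedBlowup.pureVec_eq_neg_of_comp_apply Φ Ψ hΦ.map_C_C hX i (hΨ.pureVec_eq_zero_of_mem_vars hw hρ i hmod hpure) hid

/-- **`w*` of a composite** (ours): if `Φ` and `Ψ` are both pure-free on the slots lighter than `m` (and `Ψ ≡ id (mod σ)` on those
slots), so is `Φ ∘ Ψ` — engine 1's "`w*(Φ ∘ Ψ) ≥ min (w*(Φ), w*(Ψ))`".
[cite: AbramovichTemkinWlodarczyk2024, Thm. 5.3.1 (2)–(3) (p. 1578)] -/
theorem IsGradedHom.pureVec_comp_eq_zero_of_lt {Φ Ψ : (MvPolynomial ι k)[X] →+* (MvPolynomial ι k)[X]}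
    (hΦ : IsGradedHom w ρ Φ) (hΨ : IsGradedHom w ρ Ψ) (hX : Φ X = X) (hw : ∀ j, 0 ≤ w j) (hρ : 0 < ρ) {m : M}
    (hmod : ∀ i, w i < m → Ψ (C (MvPolynomial.X i)) - C (MvPolynomial.X i) ∈ Ideal.span {(X : (MvPolynomial ι k)[X])})
    (hΦm : ∀ j, w j < m → pureVec Φ j = 0) (hΨm : ∀ j, w j < m → pureVec Ψ j = 0) :
    ∀ j, w j < m → pureVec (Φ.comp Ψ) j = 0 := fun j hj => by
  rw [hΦ.pureVec_comp hΨ hX hw hρ j (hmod j hj) (fun l hl => hΦm l (hl.trans hj)), hΦm j hj, hΨm j hj, add_zero]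

/-- **Graded CP on the whole class `≤ m`** (ours): `Φ, Ψ` graded, `Φ σ = σ`, `Ψ ≡ id (mod σ)` and `Φ` pure-free below `m` ⟹ on
every slot of weight `≤ m`, `pureVec (Φ ∘ Ψ) i = pureVec Φ i + pureVec Ψ i`.
[cite: AbramovichTemkinWlodarczyk2024, Thm. 5.3.1 (2)–(3) (p. 1578)] -/
theorem IsGradedHom.pureVec_comp_of_le {Φ Ψ : (MvPolynomial ι k)[X] →+* (MvPolynomial ι k)[X]}
    (hΦ : IsGradedHom w ρ Φ) (hΨ : IsGradedHom w ρ Ψ) (hX : Φ X = X) (hw : ∀ j, 0 ≤ w j) (hρ : 0 < ρ) {m : M}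
    (hmod : ∀ i, Ψ (C (MvPolynomial.X i)) - C (MvPolynomial.X i) ∈ Ideal.span {(X : (MvPolynomial ι k)[X])})
    (hΦm : ∀ j, w j < m → pureVec Φ j = 0) {i : ι} (hi : w i ≤ m) :
    pureVec (Φ.comp Ψ) i = pureVec Φ i + pureVec Ψ i :=
  hΦ.pureVec_comp hΨ hX hw hρ i (hmod i) fun j hj => hΦm j (hj.trans_le hi)

/-- **Three-factor graded CP** (ours; the shape used in LEMMA FC (B3) for `Φ_τ ∘ Φ_{tτ} ∘ Φ_{sτ}`): three graded substitutions
fixing `σ`, `≡ id (mod σ)`, the first two pure-free below `m` ⟹ on every slot of weight `≤ m` the pure vector of the composite is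
the SUM of the three pure vectors. [cite: AbramovichTemkinWlodarczyk2024, Thm. 5.3.1 (2)–(3) (p. 1578)] -/
theorem IsGradedHom.pureVec_comp_comp {Φ Ψ Θ : (MvPolynomial ι k)[X] →+* (MvPolynomial ι k)[X]}
    (hΦ : IsGradedHom w ρ Φ) (hΨ : IsGradedHom w ρ Ψ) (hΘ : IsGradedHom w ρ Θ) (hΦX : Φ X = X) (hΨX : Ψ X = X)
    (hw : ∀ j, 0 ≤ w j) (hρ : 0 < ρ) {m : M}
    (hΨmod : ∀ i, Ψ (C (MvPolynomial.X i)) - C (MvPolynomial.X i) ∈ Ideal.span {(X : (MvPolynomial ι k)[X])})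
    (hΘmod : ∀ i, Θ (C (MvPolynomial.X i)) - C (MvPolynomial.X i) ∈ Ideal.span {(X : (MvPolynomial ι k)[X])})
    (hΦm : ∀ j, w j < m → pureVec Φ j = 0) (hΨm : ∀ j, w j < m → pureVec Ψ j = 0) {i : ι} (hi : w i ≤ m) :
    pureVec ((Φ.comp Ψ).comp Θ) i = pureVec Φ i + pureVec Ψ i + pureVec Θ i := by
  have hΦΨX : (Φ.comp Ψ) X = X := by rw [RingHom.comp_apply, hΨX, hΦX]
  have hΦΨm : ∀ j, w j < m → pureVec (Φ.comp Ψ) j = 0 :=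
    hΦ.pureVec_comp_eq_zero_of_lt hΨ hΦX hw hρ (fun j _ => hΨmod j) hΦm hΨm
  rw [(hΦ.comp hΨ).pureVec_comp_of_le hΘ hΦΨX hw hρ hΘmod hΦΨm hi, hΦ.pureVec_comp_of_le hΨ hΦX hw hρ hΨmod hΦm hi]

/-! ## Graded FC (A): the even-class cancellation with `hvars` discharged -/

/-- **Graded FC (A)** (ours): `Φ` graded with `Φ σ = σ` and pure-free below `w i`, `Ψ` graded with `Ψ ε_i ≡ ε_i (mod σ)` and
`Φ_{−σ} (Ψ ε_i) = ε_i` ⟹ `pureVec (Φ ∘ Ψ) i = pureVec Φ i − τ (pureVec Φ i)`.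
[cite: AbramovichTemkinWlodarczyk2024, Thm. 5.3.1 (2)–(3) (p. 1578)] -/
theorem IsGradedHom.pureVec_comp_of_twistConj_apply {Φ Ψ : (MvPolynomial ι k)[X] →+* (MvPolynomial ι k)[X]}
    (hΦ : IsGradedHom w ρ Φ) (hΨ : IsGradedHom w ρ Ψ) (hX : Φ X = X) (hw : ∀ j, 0 ≤ w j) (hρ : 0 < ρ) (i : ι)
    (hmod : Ψ (C (MvPolynomial.X i)) - C (MvPolynomial.X i) ∈ Ideal.span {(X : (MvPolynomial ι k)[X])})
    (hpure : ∀ j, w j < w i → pureVec Φ j = 0)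
    (hinv : WeightedBlowup.twistConj Φ (Ψ (C (MvPolynomial.X i))) = C (MvPolynomial.X i)) :
    pureVec (Φ.comp Ψ) i = pureVec Φ i - sigmaNeg (pureVec Φ i) :=
  WeightedBlowup.pureVec_comp_of_twistConj_apply Φ Ψ hΦ.map_C_C hX i hinv
    (hΨ.pureVec_eq_zero_of_mem_vars hw hρ i hmod hpure)

/-- **Graded FC (A), even-class cancellation** (ours): in the situation above the `σ^n`-coefficient of `pureVec (Φ ∘ Ψ) i` vanishes
for every EVEN `n`. [cite: AbramovichTemkinWlodarczyk2024, Thm. 5.3.1 (2)–(3) (p. 1578)] -/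
theorem IsGradedHom.coeff_pureVec_comp_eq_zero_of_even {Φ Ψ : (MvPolynomial ι k)[X] →+* (MvPolynomial ι k)[X]}
    (hΦ : IsGradedHom w ρ Φ) (hΨ : IsGradedHom w ρ Ψ) (hX : Φ X = X) (hw : ∀ j, 0 ≤ w j) (hρ : 0 < ρ) (i : ι)
    (hmod : Ψ (C (MvPolynomial.X i)) - C (MvPolynomial.X i) ∈ Ideal.span {(X : (MvPolynomial ι k)[X])})
    (hpure : ∀ j, w j < w i → pureVec Φ j = 0)
    (hinv : WeightedBlowup.twistConj Φ (Ψ (C (MvPolynomial.X i))) = C (MvPolynomial.X i))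
    {n : ℕ} (hn : Even n) : (pureVec (Φ.comp Ψ) i).coeff n = 0 :=
  WeightedBlowup.coeff_pureVec_comp_of_twistConj_apply_eq_zero Φ Ψ hΦ.map_C_C hX i hinv
    (hΨ.pureVec_eq_zero_of_mem_vars hw hρ i hmod hpure) hn

/-- … and on a slot lighter than every pure term of `Φ`, `Φ ∘ Ψ` has no pure term either (ours).
[cite: AbramovichTemkinWlodarczyk2024, Thm. 5.3.1 (2)–(3) (p. 1578)] -/
theorem IsGradedHom.pureVec_comp_of_twistConj_apply_eq_zero {Φ Ψ : (MvPolynomial ι k)[X] →+* (MvPolynomial ι k)[X]}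
    (hΦ : IsGradedHom w ρ Φ) (hΨ : IsGradedHom w ρ Ψ) (hX : Φ X = X) (hw : ∀ j, 0 ≤ w j) (hρ : 0 < ρ) (i : ι)
    (hmod : Ψ (C (MvPolynomial.X i)) - C (MvPolynomial.X i) ∈ Ideal.span {(X : (MvPolynomial ι k)[X])})
    (hpure : ∀ j, w j < w i → pureVec Φ j = 0)
    (hinv : WeightedBlowup.twistConj Φ (Ψ (C (MvPolynomial.X i))) = C (MvPolynomial.X i))
    (hi : pureVec Φ i = 0) : pureVec (Φ.comp Ψ) i = 0 :=
  WeightedBlowup.pureVec_comp_of_twistConj_apply_eq_zero Φ Ψ hΦ.map_C_C hX i hinv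
    (hΨ.pureVec_eq_zero_of_mem_vars hw hρ i hmod hpure) hi

end GradedPure

end Literature.AlgebraicGeometry.Resolution.WeightedBlowup
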